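import Literature.IUT.HodgeTheaters.PMBaseKitModel
import Literature.IUT.HodgeTheaters.PMBaseEx63Proofs

/-!
# [IUTchI] Ex 6.3 (ii): the negative equivariance `hE` HOLDS in the consistency model (non-vacuity)

Mochizuki, *Inter-universal Teichmüller theory I*, §6, Example 6.3 (ii) p. 161, kurims manuscript (May 2020)
[claim: Mochizuki2012, status: disputed]. PROOF-ONLY companion (theorems, no definitions) to abc-iut-L5-t4's
`PMBaseKitModel.lean` / `PMBaseModels.lean` and abc-iut-L5-t13's `PMBaseEx63Proofs.lean`, by the wave-4
discharge seat abc-iut-w4-d073 (home layer L5); node ids IUTchI:Ex6.3(ii) (and the conditional discharges of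
IUTchI:Prop6.6(ii)(iii), IUTchI:Prop6.8(i) that take `hE` by name; plan/FACT-LIST.md rows F-2027, F-2017,
F-2018, F-2034).

Context. The discharges of [IUTchI] Prop 6.6 (ii), (iii) and Prop 6.8 (i) over the frozen base interface
`PMBaseKit` (abc-iut-L5-t13, `PMBaseBridgePropsProofs5/9`) are CONDITIONAL on
`hE : ∀ γ : 𝔽_l^{⋊±}, γ.IsNegative → Ex63.Equivariant K γ` — the negative half of the printed "one verifies
immediately that `φ^{Θell}_±` is equivariant" — and abc-iut-L5-t13 proved that `hE` is NOT derivable from the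
interface (`Ex63.exists_kit_not_equivariant`, p407937) while REDUCING it to one kit-shaped condition
(`Ex63.equivariant_of_negCompat`, p410816: a negative automorphism of `𝒟_v` and a lift of `(0, −1)` with
`a ≫ φ^{Θell}_{•,v} = φ^{Θell}_{•,v} ≫ b`). This file closes the remaining logical question — is `hE` SATISFIABLE
together with every interface clause? — in the affirmative:

* `Ex63.negCompat_toyKit` — abc-iut-L5-t4's consistency model `PMBaseKit.toyKit` satisfies the `[−1]`-compatibility:
  at every `v`, `a = −1 ∈ Aut(𝒟_v) = {±1}` and the lift `b = (0, −1) ∈ AGL₁(𝔽_l) = Aut(𝒟^{⊚±})` commute with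
  `φ^{Θell}_{•,v} = 1`;
* `Ex63.equivariant_toyKit_of_isNegative` — hence `hE` HOLDS for the toy kit: the conditional discharges of
  Prop 6.6 (ii)/(iii), 6.8 (i) are NOT vacuous, and together with p407937 the hypothesis `hE` is certified
  INDEPENDENT-AND-CONSISTENT relative to `PMBaseKit` (it must be taken BY NAME by cone consumers until the
  interface records the `[−1]`-compatibility of `φ^{Θell}_{•,v}`; plan/GAP-LEDGER discipline, D-0067).

Record only; nothing here takes a side on any disputed step; typed ≠ proved.
-/

namespace Literature.IUT.HodgeTheaters

open CategoryTheory

namespace PMBaseKit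

/-- **The `[−1]`-compatibility of `φ^{Θell}_{•,v}` holds in the consistency model** (hypothesis `hneg` of
abc-iut-L5-t13's `Ex63.equivariant_of_negCompat`, for abc-iut-L5-t4's `toyKit`): at every valuation the negative
automorphism `−1` of the model `𝒟_v` acts on `±`-label classes by `z ↦ −z`, and with the lift `(0, −1)` of
`(0, −1) ∈ 𝔽_l^{⋊±}` to `Aut_±(𝒟^{⊚±})` one has `(−1) ≫ φ^{Θell}_{•,v} = φ^{Θell}_{•,v} ≫ (0, −1)`.
[claim: Mochizuki2012, status: disputed] -/
theorem Ex63.negCompat_toyKit (l : ℕ) [Fact l.Prime] (hl : l ≠ 2) (v : (toyKit l hl).V) :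
    ∃ a : (toyKit l hl).model v ≅ (toyKit l hl).model v,
      (toyKit l hl).labMap v a = labNeg ((toyKit l hl).isLocal_model v) ∧
        ∃ b ∈ Ex63.lifts (toyKit l hl) (FlPM.mk 0 (-1)),
          a.hom ≫ (toyKit l hl).phiEll v = (toyKit l hl).phiEll v ≫ ((toyKit l hl).atV v).map b.hom := by
  classical
  -- the negative automorphism `−1` of the local model object
  let a : (toyKit l hl).model v ≅ (toyKit l hl).model v :=
    ⟨(-1 : ℤˣ), (-1 : ℤˣ), by change (-1 : ℤˣ) * (-1) = 1; simp, by change (-1 : ℤˣ) * (-1) = 1; simp⟩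
  -- the lift `(0, −1) ∈ AGL₁(𝔽_l)` of `(0, −1) ∈ 𝔽_l^{⋊±}`
  let g : FlPM l := FlPM.mk 0 (-1)
  let b : Aut (toyKit l hl).gModel :=
    ⟨Model.pmToAGL l g, Model.pmToAGL l (g⁻¹),
      by change Model.pmToAGL l (g⁻¹) * Model.pmToAGL l g = 1; rw [← map_mul, inv_mul_cancel, map_one],
      by change Model.pmToAGL l g * Model.pmToAGL l (g⁻¹) = 1; rw [← map_mul, mul_inv_cancel, map_one]⟩
  refine ⟨a, ?_, b, ⟨?_, ?_⟩, ?_⟩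
  · -- `LabCusp^±(−1) = (z ↦ −z) = labNeg`
    have hneg : ∀ z : ZMod l, labNeg ((toyKit l hl).isLocal_model v) z = -z := by
      intro z
      obtain ⟨ε, hε⟩ : ∃ ε : ℤˣ, signPerm l ε =
          ((toyKit l hl).labPM v ((toyKit l hl).model v) ((toyKit l hl).isLocal_model v)).chart₀ :=
        ((toyKit l hl).labPM v ((toyKit l hl).model v) ((toyKit l hl).isLocal_model v)).chart₀_mem
      change (((toyKit l hl).labPM v ((toyKit l hl).model v) ((toyKit l hl).isLocal_model v)).chart₀.trans
        ((signPerm l (-1)).trans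
          ((toyKit l hl).labPM v ((toyKit l hl).model v) ((toyKit l hl).isLocal_model v)).chart₀.symm)) z = -z
      rw [← hε]
      change (signPerm l ε).symm (signPerm l (-1) (signPerm l ε z)) = -z
      rw [Equiv.symm_apply_eq]
      simp [Units.smul_def, smul_neg]
    refine Equiv.ext fun z => ?_
    have hz := hneg (z : ZMod l)
    change (signPerm l (-1) : Equiv.Perm (ZMod l)) (z : ZMod l) =
      (labNeg ((toyKit l hl).isLocal_model v) : Equiv.Perm (ZMod l)) (z : ZMod l)
    rw [hz, signPerm_apply, Units.neg_smul, one_smul]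
  · -- `b ∈ Aut_±(𝒟^{⊚±})`: its image in `𝔽_l^⋇` is the class of `−1`, i.e. trivial
    rw [mem_autPMg_iff]
    change QuotientGroup.mk' _ (SemidirectProduct.rightHom (Model.pmToAGL l g)) = 1
    rw [QuotientGroup.mk'_apply, QuotientGroup.eq_one_iff, mem_unitsPlusMinus_iff]
    right
    ext
    simp [Model.pmToAGL, g, FlPM.mk]
  · -- `b` acts on `LabCusp^±(𝒟^{⊚±}) = 𝔽_l` as `(0, −1)` does (the fixed chart is the identity)
    have h1 : FlPM.toPerm l 1 = 1 := map_one _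
    have key : ∀ z : ZMod l, (Model.aglPerm l (Model.pmToAGL l g)) z =
        ((FlPM.toPerm l 1).trans ((FlPM.toPerm l g).trans (FlPM.toPerm l 1).symm)) z := fun z => by
      rw [h1]
      change ((Model.pmToAGL l g).right : ZMod l) * z + (Model.pmToAGL l g).left.toAdd = g • z
      simp [Model.pmToAGL, g, FlPM.mk_smul, Units.smul_def]
    exact Equiv.ext key
  · -- `(−1) ≫ φ^{Θell}_{•,v} = φ^{Θell}_{•,v} ≫ (0, −1)` in `AGL₁(𝔽_l)`
    change (1 : Model.AGL l) * Model.signToAGL l (-1) = Model.pmToAGL l g * 1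
    rw [one_mul, mul_one]
    ext <;> simp [Model.signToAGL, Model.pmToAGL, g, FlPM.mk]

/-- **`hE` holds in the consistency model**: over abc-iut-L5-t4's `toyKit`, `φ^{Θell}_±` IS equivariant for
every negative `γ ∈ 𝔽_l^{⋊±}` ([IUTchI] Ex 6.3 (ii) p. 161, negative half) — by abc-iut-L5-t13's
`Ex63.equivariant_of_negCompat`. So the hypothesis `hE` of the conditional discharges of Prop 6.6 (ii)/(iii) and
Prop 6.8 (i) is satisfiable together with every clause of `PMBaseKit` (non-vacuity), while p407937 shows it is
not derivable from them (independence). [claim: Mochizuki2012, status: disputed] -/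
theorem Ex63.equivariant_toyKit_of_isNegative (l : ℕ) [Fact l.Prime] (hl : l ≠ 2) {γ : FlPM l}
    (hγ : γ.IsNegative) : Ex63.Equivariant (toyKit l hl) γ :=
  Ex63.equivariant_of_negCompat (Ex63.negCompat_toyKit l hl) hγ

end PMBaseKit

end Literature.IUT.HodgeTheaters
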